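import Mathlib
import HarnessLib
import Summits.HubbardSuperconductivity.HubbardSuperconductivity.Theses.WeakCouplingBCS

/-!
# Sketch — crux idea `quenched-corner-by-square-completion` for stmt-HubbardSuperconductivity-2009
(`WeakCouplingBCS.WcbcsSsbToTorusLRO` = `NodalWardXY.SsbToTorusLRO`).

First lemmas of the line, stated as `Prop`s over existing declarations (nothing is proved here):
* `SquareCompletionBound` — the Bogoliubov square completion read from the SOURCED side:
  `E₀(K_μ − (t/L²)P†P) − h²L²/t ≤ E₀(K_μ − h(P + P†))` for every `h` and `t > 0`.
* `TracialCuspBound` — the tracial Koma–Tasaki density at field `s` bounds the energy gain beyond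
  `s` from below (monotone supergradients of the concave sourced ground energy).
* `QuenchedGSOrderFromGain` — every ground state of the quenched model carries at least the
  quenched energy gain as d-wave pair order (one-line variational identity).
* `QuenchedCornerOrder` — END-TO-END first checkable statement: `HasDWaveOrder U μ` ⇒ every ground
  state of `K_μ − (t/L²)P†P` has d-wave LRO `≥ m(U,μ)² − ε` for every small `t > 0`, `L ≥ L₀(t)`.
* the two transfer statements `SeededRecentring`, `HolderCorner` (hypothesis-free, one sector).
-/

noncomputable section

namespace Summit.HubbardSuperconductivity.HubbardSuperconductivity.Cruxes.WcbcsSsbToTorusLRO.QuenchedCorner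

open Literature.MathematicalPhysics.QuantumLattice Literature.Barriers.HubbardSuperconductivity
open Matrix Filter
open scoped ComplexOrder Topology

/-- Index type of the torus Fock space. -/
abbrev ι (L : ℕ) : Type := Finset (Orb (FermionTorus 2 L))

/-- The d-wave pair field `P_L = pairField dWaveFormFactor L` (`= √2 Δ_d`). -/
abbrev pF (L : ℕ) [NeZero L] : Matrix (ι L) (ι L) ℂ := pairField dWaveFormFactor L

/-- The quenched (number-conserving, mean-field d-wave seed) GRAND-CANONICAL torus Hamiltonian
`K_μ − (t/L²) P†P`, `K_μ = hubbardTorusWith 2 L 1 U μ`. -/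
def quenchedGC (L : ℕ) [NeZero L] (U μ t : ℝ) : Matrix (ι L) (ι L) ℂ :=
  hubbardTorusWith 2 L 1 U μ - ((t / (L : ℝ) ^ 2 : ℝ) : ℂ) • ((pF L)ᴴ * pF L)

/-- The quenched CANONICAL torus Hamiltonian `H − (t/L²) P†P`, `H = hubbardTorus 2 L 1 U`. -/
def quenchedCan (L : ℕ) [NeZero L] (U t : ℝ) : Matrix (ι L) (ι L) ℂ :=
  hubbardTorus 2 L 1 U - ((t / (L : ℝ) ^ 2 : ℝ) : ℂ) • ((pF L)ᴴ * pF L)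

/-- d-wave pair LRO density `L⁻⁴ Re⟨φ, P†P φ⟩` of a torus state. -/
def lro (L : ℕ) [NeZero L] (φ : Fock (Orb (FermionTorus 2 L))) : ℝ :=
  (expect ((pF L)ᴴ * pF L) φ).re / (L : ℝ) ^ 4

/-- FIRST LEMMA (square completion, finite `L`, provable now). From the operator inequality
`(√t L⁻¹ P − h L t^{-1/2})†(√t L⁻¹ P − h L t^{-1/2}) ≥ 0`, i.e.
`−h (P + P†) ≥ −(t/L²) P†P − (h² L²/t)·1`, and monotonicity of the ground energy:
`E₀(K_μ − (t/L²)P†P) − h²L²/t ≤ E₀(dWaveSourceTorus L U μ h)` for all real `h` and `t > 0`. -/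
def SquareCompletionBound : Prop :=
  ∀ (L : ℕ) [NeZero L] (U μ h t : ℝ), 0 < t →
    (quenchedGC L U μ t).groundEnergy - h ^ 2 * (L : ℝ) ^ 2 / t ≤
      (dWaveSourceTorus L U μ h).groundEnergy

/-- LEMMA D (tracial slope ⇒ energy gain, finite `L`, provable now). `h ↦ E₀(K_μ − h(P+P†))` is
concave; its one-sided derivatives are `−max/−min` of `⟨P + P†⟩` over ground states (Danskin), the
tracial value `2 L² · dWaveSourceDensity L U μ s` lies between them, and supergradients are
monotone; integrating from `s` to `h`:
`(h − s) · 2L² · dWaveSourceDensity L U μ s ≤ E₀(K_μ) − E₀(K_μ − h(P + P†))` for `0 ≤ s ≤ h`. -/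
def TracialCuspBound : Prop :=
  ∀ (L : ℕ) [NeZero L] (U μ s h : ℝ), 0 ≤ s → s ≤ h →
    (h - s) * (2 * (L : ℝ) ^ 2 * dWaveSourceDensity L U μ s) ≤
      (hubbardTorusWith 2 L 1 U μ).groundEnergy - (dWaveSourceTorus L U μ h).groundEnergy

/-- LEMMA (every quenched ground state carries the gain, finite `L`, one line): for a normalised
ground state `Φ` of `K_μ − (t/L²)P†P`, `t L² · lro Φ = ⟨Φ, K_μ Φ⟩ − E₀(quenched) ≥ E₀(K_μ) − E₀(quenched)`. -/
def QuenchedGSOrderFromGain : Prop :=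
  ∀ (L : ℕ) [NeZero L] (U μ t : ℝ) (Φ : Fock (Orb (FermionTorus 2 L))), 0 < t →
    (quenchedGC L U μ t).IsGroundStateVector Φ → star Φ ⬝ᵥ Φ = 1 →
      (hubbardTorusWith 2 L 1 U μ).groundEnergy - (quenchedGC L U μ t).groundEnergy ≤
        t * (L : ℝ) ^ 2 * lro L Φ

/-- FIRST CHECKABLE STATEMENT OF THE LINE (GC quenched corner persistence with the sharp constant):
Koma–Tasaki d-wave order `m = dWaveOrderParameter U μ > 0` implies that for every small `t > 0` and
all `L ≥ L₀(t)`, EVERY ground state of the number-conserving quenched model `K_μ − (t/L²)P†P` has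
d-wave pair LRO `≥ m² − ε`. Follows from the three lemmas above with `h := (1−ε″)(m−2ε′)·t`. -/
def QuenchedCornerOrder : Prop :=
  ∀ (U μ : ℝ), HasDWaveOrder U μ → ∀ ε : ℝ, 0 < ε →
    ∃ t₀ : ℝ, 0 < t₀ ∧ ∀ t ∈ Set.Ioo (0 : ℝ) t₀, ∃ L₀ : ℕ, ∀ (L : ℕ) [NeZero L], L₀ ≤ L →
      ∀ Φ : Fock (Orb (FermionTorus 2 L)),
        (quenchedGC L U μ t).IsGroundStateVector Φ → star Φ ⬝ᵥ Φ = 1 →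
          dWaveOrderParameter U μ ^ 2 - ε ≤ lro L Φ

/-- TRANSFER, part 1 (seeded recentring at FIXED `t > 0`; density-level statement, hypothesis-free
except for the crux's own density-matching antecedent which the consumer supplies): the
`(N_L, S^z = 0)`-sector excitation of the quenched CANONICAL model above the quenched GRAND-CANONICAL
ground energy at `μ` is `≤ ε t L²` for small `t` (thermodynamically it is `O(t²)`: the seed shifts
the preferred density only at order `t`). -/
def SeededRecentring (U δ μ : ℝ) : Prop :=
  ∀ ε : ℝ, 0 < ε → ∃ t₀ : ℝ, 0 < t₀ ∧ ∀ t ∈ Set.Ioo (0 : ℝ) t₀, ∃ L₀ : ℕ,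
    ∀ (L : ℕ) [NeZero L], L₀ ≤ L → Even L →
      (quenchedCan L U t).minEnergyOn (szSector (2 * ⌊(1 - δ) * (L : ℝ) ^ 2 / 2⌋₊) 0) -
          μ * ((2 * ⌊(1 - δ) * (L : ℝ) ^ 2 / 2⌋₊ : ℕ) : ℝ) - (quenchedGC L U μ t).groundEnergy ≤
        ε * t * (L : ℝ) ^ 2

/-- TRANSFER, part 2 (Hölder corner in ONE sector; hypothesis-free; the amplitude-sector residue):
uniformly in large even `L`, the d-wave LRO of every sector ground state of the quenched canonical
model at seed `t` exceeds that of every sector ground state of the pure model by at most `C t^{1−a}`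
(`a < 1`; the thermodynamic-limit exponent is `a = 1/2`, the longitudinal/amplitude susceptibility of
a `U(1)`-broken phase in `2+1` dimensions). -/
def HolderCorner (U δ : ℝ) : Prop :=
  ∃ C a t₀ : ℝ, 0 < C ∧ a < 1 ∧ 0 < t₀ ∧ ∀ t ∈ Set.Ioo (0 : ℝ) t₀, ∃ L₀ : ℕ,
    ∀ (L : ℕ) [NeZero L], L₀ ≤ L → Even L →
      ∀ ψ₀ ψ₁ : Fock (Orb (FermionTorus 2 L)),
        IsGroundStateInSector (hubbardTorus 2 L 1 U) (2 * ⌊(1 - δ) * (L : ℝ) ^ 2 / 2⌋₊) 0 ψ₀ →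
        star ψ₀ ⬝ᵥ ψ₀ = 1 →
        IsGroundStateInSector (quenchedCan L U t) (2 * ⌊(1 - δ) * (L : ℝ) ^ 2 / 2⌋₊) 0 ψ₁ →
        star ψ₁ ⬝ᵥ ψ₁ = 1 →
          lro L ψ₁ - lro L ψ₀ ≤ C * t ^ (1 - a)

/-- The crux, by name (to make sure the sketch and the route file talk about the same statement). -/
example : Prop := Summit.HubbardSuperconductivity.HubbardSuperconductivity.Theses.WeakCouplingBCS.WcbcsSsbToTorusLRO

end Summit.HubbardSuperconductivity.HubbardSuperconductivity.Cruxes.WcbcsSsbToTorusLRO.QuenchedCorner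

end
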